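/-
Origin: expansion seat `planner-pub-hodgecm-pohl-g15-0`, handover #8 2026-08-18T16:19:39Z (md5 22238c9a69a0027052c2320df711f064, 277 l.; RUN-32 CANDIDATE ROW, ON REQUEST ONLY — TREE-SHAPE SPLIT (≤400 l.) of the pohl lineage, source lines verbatim; NEW first part; lands AFTER AnyCMFieldDictionary; rewrites import Pohl15.AnyCMFieldDictionary -> HodgeCM.Proofs.Pohlmann.AnyCMFieldDictionary x1) (`HOME/pub-hodgecm-pohl-g15/lean/Pohl15/AnyCMFieldInclusions.lean`, md5 22238c9a, 277 lines);
landed by the packager successor (mc-unitary-1-g3, gen-8 kit) in gate run 32 as `HodgeCM/Proofs/Pohlmann/AnyCMFieldInclusions.lean` (import ^import Pohl15\.AnyCMFieldDictionary[ \t]*$→import HodgeCM.Proofs.Pohlmann.AnyCMFieldDictionary ×1).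
-/
/-
Copyright: pub-hodgecm formalisation cell (harness21, 2026). New file (not vendored).
Origin: HOME/pub-hodgecm-pohl-g15/lean/Pohl15/AnyCMFieldInclusions.lean — session planner-pub-hodgecm-pohl-g15-0 (unit pub-hodgecm-pohl-g15),
EXPANSION part (b) `PohlmannSpan`, generation 15: TREE-SHAPE STAGING under the 400-line rule of lean/CONVENTIONS.md §2 — part 2/3
of the split of `HodgeCM/Proofs/Pohlmann/AnyCMField.lean` (pohl-g9, gate run 26; 723 l., md5 9785dda4ddb5): source lines 285–516 VERBATIM; the module docstring below is new (it only describes the cut).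
Intended final place: `HodgeCM/Proofs/Pohlmann/AnyCMFieldInclusions.lean` (module `HodgeCM.Proofs.Pohlmann.AnyCMFieldInclusions`); WIP import `Pohl15.AnyCMFieldDictionary` → `HodgeCM.Proofs.Pohlmann.AnyCMFieldDictionary` on landing.
-/
import Summits.HodgeConjecture.HodgeCM.Proofs.Pohlmann.AnyCMFieldDictionary

/-!
# Pohlmann's theorem for an arbitrary CM field, II: both inclusions and the print statements

Second part of the former `AnyCMField.lean` (pohl-g9), split at its section boundaries under the tree's 400-line rule
(lean/CONVENTIONS.md §2); every declaration below is the source's, verbatim.  Contents: `section AnyF` — both inclusions of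
Pohlmann's theorem (Gao–Ullmo, *J. Inst. Math. Jussieu* **25** (2025) Thm 3.1) for an ARBITRARY CM field `F`, the weights met by
`B_ℂ` being stable under `Gal(E^c/ℚ)`; the print statements `PohlmannBasisCM` (`B^p(A′) ⊗ ℂ = ⨁_{S : IsHodgeWeightC} V_S`) and
`PohlmannSpanCM`; `section Print` and the closing implications `pohlmannBasisCM_holds`, `pohlmannBasisCM_of_facts`
(model axioms + N1–N4), `pohlmannBasis_of_pohlmannBasisCM`, `pohlmannSpanCM_of_facts`, `pohlmannSpan_of_pohlmannSpanCM`.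
The dictionary and the eigencharacter are in `AnyCMFieldDictionary.lean` (imported); the basis / dimension statements and the
cross-model identity are in `AnyCMField.lean`, which imports this file and keeps the module name.
-/

noncomputable section

open scoped TensorProduct NumberField BigOperators
open Polynomial

namespace HodgeCM

open Literature.AlgebraicGeometry.Motives (CMType HodgeStructure)
open Literature.AlgebraicGeometry.Motives.HodgeStructure (ofRat ofRat_apply)
open HodgeCM.Pohlmann HodgeCM.GaoUllmo HodgeCM.CMTypeOps

attribute [local instance] Classical.propDecidable

namespace Universe

variable {U : Universe}

/-! ### Both inclusions of Pohlmann's theorem for an arbitrary CM field `F` -/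

section AnyF

variable {F : CMField} {n : ℕ} {Θ : Fin (n + 1) → CMType F} {ι : Type} [Fintype ι]
  {j : ι → Fin (n + 1)} {a : ι → 𝓞 F} {c : ι → ℕ} {Mi : ι → U.Mor (U.cmProd F Θ) (U.cmProd F Θ)}

/-- `T_B` (the weights met by `B_ℂ`) is stable under `Gal(E^c/ℚ)` — any CM field `F` (compare `meets_permWeight`, Galois `F`). -/
theorem meets_permWeight_galTOf (M : U.ModelAxioms) (h29 : U.Fact_weightSpan)
    (hM : ∀ i, U.IsFactorAct F Θ (j i) (a i : F) (Mi i)) (hinj : Function.Injective (sepVal j a c))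
    (p : ℕ) {S : Fin (n + 1) → Finset ((F : Type) →+* ℂ)}
    (hS : (U.hodgeClassesOf (U.cmProd F Θ) p).baseChange ℂ ⊓ U.weightSpace F Θ S (2 * p) ≠ ⊥)
    (σ : galoisClosure (Fin (n + 1) → (F : Type)) ≃ₐ[ℚ] galoisClosure (Fin (n + 1) → (F : Type))) :
    (U.hodgeClassesOf (U.cmProd F Θ) p).baseChange ℂ ⊓ U.weightSpace F Θ (permWeight (galTOf σ).1 S) (2 * p) ≠ ⊥ := by
  obtain ⟨y, hy, hσy, -⟩ := exists_sepVal_eq_closure j a c S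
  rw [meets_iff_isRoot M h29 hM hinj p] at hS ⊢
  rw [hσy σ]
  rw [hy] at hS
  exact isRoot_algHom_of_isRoot _
    ((galoisClosure (Fin (n + 1) → (F : Type))).val.comp
      (σ : galoisClosure (Fin (n + 1) → (F : Type)) →ₐ[ℚ] galoisClosure (Fin (n + 1) → (F : Type)))) hS

/-- Every weight met by the Hodge classes is a Galois-closure Hodge weight — any CM field `F`
(compare `isHodgeWeight_of_meets`, Galois `F`). -/
theorem isHodgeWeightC_of_meets (M : U.ModelAxioms) (h29 : U.Fact_weightSpan) (h30 : U.Fact_weightHodge)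
    (hM : ∀ i, U.IsFactorAct F Θ (j i) (a i : F) (Mi i)) (hinj : Function.Injective (sepVal j a c))
    (p : ℕ) {S : Fin (n + 1) → Finset ((F : Type) →+* ℂ)}
    (hS : (U.hodgeClassesOf (U.cmProd F Θ) p).baseChange ℂ ⊓ U.weightSpace F Θ S (2 * p) ≠ ⊥) :
    IsHodgeWeightC Θ p S := by
  refine ⟨?_, fun σ => ?_⟩
  · obtain ⟨hp, hq⟩ := types_of_meets h30 p hS
    have hsum : (∑ j, ∑ s ∈ S j, ind (Θ j) s) + (∑ j, ∑ s ∈ S j, (1 - ind (Θ j) s)) =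
        ((∑ j, (S j).card : ℕ) : ℤ) := by
      rw [← Finset.sum_add_distrib, Nat.cast_sum]
      refine Finset.sum_congr rfl fun j _ => ?_
      rw [← Finset.sum_add_distrib, Finset.sum_congr rfl fun s _ => add_sub_cancel (ind (Θ j) s) 1]
      simp
    rw [hp, hq] at hsum
    have : ((∑ j, (S j).card : ℕ) : ℤ) = ((2 * p : ℕ) : ℤ) := by rw [← hsum]; push_cast; ring
    exact_mod_cast this
  · have h := (types_of_meets h30 p (meets_permWeight_galTOf M h29 hM hinj p hS σ)).1
    rw [sum_sum_permWeight (galTOf σ).1 S fun j t => ind (Θ j) t] at h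
    simpa only [galTOf_apply] using h

/-- **`⊇` for any CM field `F`**: the weight space of a Galois-closure Hodge weight lies in `B^p(A′) ⊗ ℂ`
(Gao–Ullmo, proof of Thm 3.1, p0009 L46–L47; compare `weightSpace_le_baseChange_hodgeClassesOf`, Galois `F`). -/
theorem weightSpace_le_baseChange_hodgeClassesOf_C (h29 : U.Fact_weightSpan) (h30 : U.Fact_weightHodge)
    (hM : ∀ i, U.IsFactorAct F Θ (j i) (a i : F) (Mi i))
    (hinj : Function.Injective (sepVal j a c)) (p : ℕ) {S : Fin (n + 1) → Finset ((F : Type) →+* ℂ)}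
    (hS : IsHodgeWeightC Θ p S) :
    U.weightSpace F Θ S (2 * p) ≤ (U.hodgeClassesOf (U.cmProd F Θ) p).baseChange ℂ := by
  classical
  -- `λ(S) = y ∈ E^c`, `χ = minpoly y`, `Q = χ(T)`
  obtain ⟨y, hy, -, hPy⟩ := exists_sepVal_eq_closure j a c S
  set T : U.Coh (U.cmProd F Θ) (2 * p) →ₗ[ℚ] U.Coh (U.cmProd F Θ) (2 * p) := U.sepOp c Mi (2 * p) with hT
  set χ : ℚ[X] := minpoly ℚ y with hχ
  set Q : U.Coh (U.cmProd F Θ) (2 * p) →ₗ[ℚ] U.Coh (U.cmProd F Θ) (2 * p) := aeval T χ with hQ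
  have hQC : Q.baseChange ℂ = aeval (T.baseChange ℂ) (χ.map (algebraMap ℚ ℂ)) :=
    baseChange_aeval_map T χ
  -- `ker Q_ℂ` is `T_ℂ`-stable
  set K' : Submodule ℂ (U.CohC (U.cmProd F Θ) (2 * p)) := LinearMap.ker (Q.baseChange ℂ) with hK'
  have hcomm : Commute (T.baseChange ℂ) (Q.baseChange ℂ) := by
    have h := (commute_X (χ.map (algebraMap ℚ ℂ))).map (aeval (T.baseChange ℂ))
    rwa [aeval_X, ← hQC] at h
  have hK'stab : ∀ z ∈ K', T.baseChange ℂ z ∈ K' := by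
    intro z hz
    rw [hK', LinearMap.mem_ker] at hz ⊢
    rw [← Module.End.mul_apply, ← hcomm.eq, Module.End.mul_apply, hz, map_zero]
  -- `ker Q_ℂ ⊆ H^{p,p}`
  have hK'le : K' ≤ (U.hodge (U.cmProd F Θ) (2 * p)).piece p p := by
    have hdec : K' = ⨆ μ, K' ⊓ Module.End.eigenspace (T.baseChange ℂ) μ := by
      have h := Submodule.inf_iSup_genEigenspace (p := K') (f := T.baseChange ℂ) hK'stab 1
      rw [iSup_eigenspace_eq_top h29 hM (2 * p), inf_top_eq] at h
      exact h
    refine hdec.le.trans (iSup_le fun μ => ?_)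
    by_cases hμ : K' ⊓ Module.End.eigenspace (T.baseChange ℂ) μ = ⊥
    · rw [hμ]; exact bot_le
    obtain ⟨z, hz, hz0⟩ := (Submodule.ne_bot_iff _).mp hμ
    obtain ⟨hzK, hzE⟩ := Submodule.mem_inf.mp hz
    -- `μ` is a root of `χ_ℂ`
    have hroot : (χ.map (algebraMap ℚ ℂ)).eval μ = 0 := by
      have h1 : Q.baseChange ℂ z = 0 := hzK
      rw [hQC, aeval_apply_of_mem_eigenspace hzE] at h1
      exact (smul_eq_zero.mp h1).resolve_right hz0
    -- `μ = λ(S')`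
    have hE : Module.End.eigenspace (T.baseChange ℂ) μ ≠ ⊥ :=
      fun h => hμ (eq_bot_iff.mpr (inf_le_right.trans h.le))
    obtain ⟨S', hS'⟩ := exists_sepVal_eq h29 hM (2 * p) hE
    -- NEW STEP: a complex root of `minpoly_ℚ(y)`, `y ∈ E^c`, is `ψ y` for an embedding `ψ : E^c → ℂ`
    have hmem : μ ∈ (minpoly ℚ y).rootSet ℂ := by
      rw [mem_rootSet]
      refine ⟨minpoly.ne_zero (IsIntegral.of_finite ℚ y), ?_⟩
      rw [aeval_def, ← eval_map]
      exact hroot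
    rw [← Algebra.IsAlgebraic.range_eval_eq_rootSet_minpoly] at hmem
    obtain ⟨ψ, hψ⟩ := hmem
    -- the element `σ_ψ ∈ Gal(E^c/ℚ)` carries `S` to `S'`
    have hSS' : permWeight (galTOf (autOfEmb ψ)).1 S = S' := by
      apply hinj
      rw [hPy ψ, hS']
      exact hψ
    -- conclude with M30 for the Galois-closure Hodge weight `S' = σ_ψ • S`
    calc K' ⊓ Module.End.eigenspace (T.baseChange ℂ) μ
        ≤ Module.End.eigenspace (T.baseChange ℂ) μ := inf_le_right
      _ = U.weightSpace F Θ S' (2 * p) := by rw [← hS', eigenspace_eq_weightSpace h29 hM hinj (2 * p) S']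
      _ ≤ (U.hodge (U.cmProd F Θ) (2 * p)).piece p p :=
          weightSpace_le_piece_of_isHodgeWeightC h30 (hSS' ▸ isHodgeWeightC_permWeight hS _)
  -- (1) the RATIONAL subspace `ker Q` consists of Hodge classes
  have hK : LinearMap.ker Q ≤ U.hodgeClassesOf (U.cmProd F Θ) p := by
    intro v hv
    have hvC : ofRat v ∈ K' := by
      rw [hK', LinearMap.mem_ker, ofRat_apply, LinearMap.baseChange_tmul, LinearMap.mem_ker.mp hv,
        TensorProduct.tmul_zero]
    change ofRat v ∈ (U.hodge (U.cmProd F Θ) (2 * p)).F p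
    exact HodgeStructure.piece_le_F _ _ _ (hK'le hvC)
  -- (2) `V_S ⊆ ker Q_ℂ = (ker Q) ⊗ ℂ ⊆ B ⊗ ℂ`
  have hχy : (χ.map (algebraMap ℚ ℂ)).eval (y : ℂ) = 0 := by
    have h : ((y : galoisClosure (Fin (n + 1) → (F : Type))) : ℂ) =
        algebraMap (galoisClosure (Fin (n + 1) → (F : Type))) ℂ y := rfl
    rw [eval_map, ← aeval_def, h, aeval_algebraMap_apply, hχ, minpoly.aeval, map_zero]
  intro x hx
  have hxK : x ∈ LinearMap.ker (Q.baseChange ℂ) := by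
    rw [LinearMap.mem_ker, hQC, aeval_apply_of_mem_eigenspace (weightSpace_le_eigenspace hM (2 * p) S hx),
      hy, hχy, zero_smul]
  rw [ker_baseChange_eq] at hxK
  exact Submodule.baseChange_mono ℂ hK hxK

/-- **Pohlmann's theorem with a chosen separating family, any CM field `F`**: `B^p ⊗ ℂ = ⨆_{S : IsHodgeWeightC} V_S`. -/
theorem baseChange_hodgeClassesOf_eq_iSupC' (M : U.ModelAxioms) (h29 : U.Fact_weightSpan)
    (h30 : U.Fact_weightHodge) (hM : ∀ i, U.IsFactorAct F Θ (j i) (a i : F) (Mi i))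
    (hinj : Function.Injective (sepVal j a c)) (p : ℕ) :
    (U.hodgeClassesOf (U.cmProd F Θ) p).baseChange ℂ =
      ⨆ (S : Fin (n + 1) → Finset ((F : Type) →+* ℂ)) (_ : IsHodgeWeightC Θ p S),
        U.weightSpace F Θ S (2 * p) := by
  refine le_antisymm ?_
    (iSup₂_le fun S hS => weightSpace_le_baseChange_hodgeClassesOf_C h29 h30 hM hinj p hS)
  refine (baseChange_hodgeClassesOf_le M h29 hM hinj p).trans (iSup₂_le fun S hS => ?_)
  exact le_iSup₂_of_le S (isHodgeWeightC_of_meets M h29 h30 hM hinj p hS) le_rfl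

end AnyF

/-! ### The print statements for an arbitrary CM field -/

/-- **Pohlmann's theorem, print form, for an ARBITRARY CM field `F`** (Gao–Ullmo, *J. Inst. Math. Jussieu* 25 (2025),
Thm 3.1 "(Pohlmann)" with `E = F^{n+1}`, `A = ∏_{j ≤ n} A_{(F,Θ_j)}`): the complexified rational Hodge classes
`B^p(A′) ⊗ ℂ ⊆ H^{2p}(A′, ℂ)` are EXACTLY the sum (direct: `iSupIndep_weightSpace_hodgeC`) of the weight spaces `V_S` of
the weights `S` with `Σ_j |S_j| = 2p` and `#{(j,s) ∈ S : σ ∘ s ∈ Θ_j} = p` for every `σ ∈ Gal(E^c/ℚ)` (`IsHodgeWeightC`).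
No hypothesis on `F` beyond CM; compare `PohlmannBasis` (`F` Galois, `pohlmannBasis_of_pohlmannBasisCM`). -/
def PohlmannBasisCM (U : Universe) : Prop :=
  ∀ (F : CMField) (n : ℕ) (Θ : Fin (n + 1) → CMType F) (p : ℕ),
    (U.hodgeClassesOf (U.cmProd F Θ) p).baseChange ℂ =
      ⨆ (S : Fin (n + 1) → Finset ((F : Type) →+* ℂ)) (_ : IsHodgeWeightC Θ p S),
        U.weightSpace F Θ S (2 * p)

/-- **The span inclusion for an ARBITRARY CM field `F`** — the shape of the landed `PohlmannSpan` with its hypotheses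
`IsGalois ℚ F → 6 ≤ finrank ℚ F →` dropped and the index condition read through `Gal(E^c/ℚ)`. -/
def PohlmannSpanCM (U : Universe) : Prop :=
  ∀ (F : CMField) (n : ℕ) (Θ : Fin (n + 1) → CMType F) (p : ℕ),
    (U.hodgeClassesOf (U.cmProd F Θ) p).map ofRat ≤
      (Submodule.span ℂ {x : U.CohC (U.cmProd F Θ) (2 * p) |
        ∃ S : Fin (n + 1) → Finset ((F : Type) →+* ℂ),
          IsHodgeWeightC Θ p S ∧ U.IsWeightVector F Θ S (2 * p) x}).restrictScalars ℚ

section Print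

variable {F : CMField} {n : ℕ} {Θ : Fin (n + 1) → CMType F}

/-- `B^p(A′) ⊗ ℂ = ⨆_{S : IsHodgeWeightC} V_S` under the model axioms and M29/M30, any CM field `F`. -/
theorem baseChange_hodgeClassesOf_eq_iSupC (M : U.ModelAxioms) (h29 : U.Fact_weightSpan)
    (h30 : U.Fact_weightHodge) (p : ℕ) :
    (U.hodgeClassesOf (U.cmProd F Θ) p).baseChange ℂ =
      ⨆ (S : Fin (n + 1) → Finset ((F : Type) →+* ℂ)) (_ : IsHodgeWeightC Θ p S),
        U.weightSpace F Θ S (2 * p) := by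
  obtain ⟨j, a, c, hinj⟩ := exists_separating_family (F := (F : Type)) n
  choose Mi hMi using fun i => exists_isFactorAct M F Θ (j i) (a i)
  have hinj' : Function.Injective (sepVal j a c) := hinj
  exact baseChange_hodgeClassesOf_eq_iSupC' M h29 h30 hMi hinj' p

/-- The weight spaces of the Galois-closure Hodge weights are independent (the sum in `PohlmannBasisCM` is direct). -/
theorem iSupIndep_weightSpace_hodgeC (M : U.ModelAxioms) (p : ℕ) :
    iSupIndep fun S : {S : Fin (n + 1) → Finset ((F : Type) →+* ℂ) // IsHodgeWeightC Θ p S} =>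
      U.weightSpace F Θ S.1 (2 * p) :=
  (iSupIndep_weightSpace M (2 * p)).comp Subtype.val_injective

end Print

/-- **Pohlmann's theorem in print form, any CM field, holds** under the model axioms M1–M28 and M29/M30. -/
theorem pohlmannBasisCM_holds (M : U.ModelAxioms) (h29 : U.Fact_weightSpan) (h30 : U.Fact_weightHodge) :
    U.PohlmannBasisCM :=
  fun _F _n _Θ p => baseChange_hodgeClassesOf_eq_iSupC M h29 h30 p

/-- **Pohlmann's theorem in print form, any CM field, holds** under the model axioms M1–M28 and the textbook facts N1–N4. -/
theorem pohlmannBasisCM_of_facts (M : U.ModelAxioms) (hN1 : U.Fact_cupExterior) (hN2 : U.Fact_cup_hodge)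
    (hN3 : U.Fact_pull_H0) (hN4 : U.Fact_hodge_F0) : U.PohlmannBasisCM :=
  pohlmannBasisCM_holds M (weightSpan_of_facts M hN1 hN3) (weightHodge_of_facts M hN1 hN2 hN3 hN4)

/-- The Galois statement is a corollary: `PohlmannBasisCM → PohlmannBasis` (pure logic + `isHodgeWeight_iff_isHodgeWeightC`). -/
theorem pohlmannBasis_of_pohlmannBasisCM (h : U.PohlmannBasisCM) : U.PohlmannBasis := by
  intro F hG n Θ p
  rw [h F n Θ p]
  exact iSup_congr fun S => iSup_congr_Prop (isHodgeWeight_iff_isHodgeWeightC Θ p S).symm fun _ => rfl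

/-- `PohlmannBasisCM → PohlmannSpanCM` (pure logic). -/
theorem pohlmannSpanCM_of_pohlmannBasisCM (h : U.PohlmannBasisCM) : U.PohlmannSpanCM := by
  intro F n Θ p
  rw [Submodule.map_le_iff_le_comap]
  intro b hb
  rw [Submodule.mem_comap, Submodule.restrictScalars_mem]
  have hbC : ofRat b ∈ (U.hodgeClassesOf (U.cmProd F Θ) p).baseChange ℂ :=
    Submodule.tmul_mem_baseChange_of_mem 1 hb
  rw [h F n Θ p] at hbC
  have hle : (⨆ (S : Fin (n + 1) → Finset ((F : Type) →+* ℂ)) (_ : IsHodgeWeightC Θ p S),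
      U.weightSpace F Θ S (2 * p)) ≤
      Submodule.span ℂ {x : U.CohC (U.cmProd F Θ) (2 * p) |
        ∃ S : Fin (n + 1) → Finset ((F : Type) →+* ℂ), IsHodgeWeightC Θ p S ∧ U.IsWeightVector F Θ S (2 * p) x} :=
    iSup₂_le fun S hS x hx => Submodule.subset_span ⟨S, hS, (U.mem_weightSpace_iff F Θ S (2 * p) x).1 hx⟩
  exact hle hbC

/-- **The span theorem for any CM field holds** under the model axioms and N1–N4. -/
theorem pohlmannSpanCM_of_facts (M : U.ModelAxioms) (hN1 : U.Fact_cupExterior) (hN2 : U.Fact_cup_hodge)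
    (hN3 : U.Fact_pull_H0) (hN4 : U.Fact_hodge_F0) : U.PohlmannSpanCM :=
  pohlmannSpanCM_of_pohlmannBasisCM (pohlmannBasisCM_of_facts M hN1 hN2 hN3 hN4)

/-- The landed statement is a corollary: `PohlmannSpanCM → PohlmannSpan` (pure logic; for Galois `F` the index sets agree,
and the degree hypothesis `6 ≤ [F:ℚ]` of `PohlmannSpan` is not used). -/
theorem pohlmannSpan_of_pohlmannSpanCM (h : U.PohlmannSpanCM) : U.PohlmannSpan := by
  intro F hG _h6 n Θ p
  refine (h F n Θ p).trans fun v hv => ?_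
  rw [Submodule.restrictScalars_mem] at hv ⊢
  refine Submodule.span_mono ?_ hv
  rintro x ⟨S, hS, hx⟩
  exact ⟨S, (isHodgeWeight_iff_isHodgeWeightC Θ p S).mpr hS, hx⟩

end Universe

end HodgeCM

end
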